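import Summits.BirchSwinnertonDyer.BirchSwinnertonDyer.Theorems.SemiOrdinaryEisensteinDescentWildSigmaDivisibilityAtThreeTowerFreeOfFlatOfManinScaling
import HarnessLib

/-!
# Route `SemiOrdinaryEisensteinDescent`, crux of record Ko′ `WildKolyvaginUpperAtThreeTowerFree` (stmt-BirchSwinnertonDyer-24696)
# and its research child J′ `WildSigmaDivisibilityAtThreeTowerFree` (stmt-24702): the DEPTH-MINIMAL residue «beyond the max»
# (cell `bsd-wall`, width seat `bsd-wall-soed-p2-w3` gen 2; `--supports stmt-BirchSwinnertonDyer-24696`, helper; BSD is not proved by this file)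

WHY. Write `c_q := c_q(E/ℚ_q)` for the local Tamagawa numbers at the primes `q ∣ N`, `c := c(Dt)` for the Manin constant of the
parametrisation datum and `t := ord₃ ∏_q c_q + v₃ c` for the depth of J′. The research child J′ of Ko′ asks, on every frame of
the wild cell, that the Kolyvagin derivative classes `P(n)` be `3^{s′}`-divisible for EVERY depth `s′ ≤ t`. Two earlier width
seats cut J′ down by FRAMES: p598295 §2 (w2 g4) shows that Ko′ needs J′ only on MULTI-CARRIER frames
(`∀ q ∣ N, ord₃ c_q < t`; the pen's act-G item J‴ `WildSigmaDivisibilityAtThreeMultiCarrier` is that text) once Jetchev's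
max-form divisibility at `3 ∣ N` under `ρ̄₃` onto (`hJmax`, displayed; the tower→mod-`3` twin of the `bsd-jet` road-K kernel,
series `Theorems/Rank1ResidualJetModP*.lean` of w2 g5) is available. But on a multi-carrier frame J‴ still asks for the SMALL
depths `s′ ≤ max_q ord₃ c_q`, and those are print-closed by the same `hJmax`. This file cuts by DEPTHS instead: the only
depths Ko′ needs from research are the ones BEYOND EVERY SINGLE CARRIER,
`J⁗ := J′'s text + ONE binder «∀ q prime, q ∣ N → ord₃ c_q < s′»` —
i.e. `max_q ord₃ c_q < s′ ≤ Σ_q ord₃ c_q + v₃ c`, which is LITERALLY the gap between Jetchev's theorem (the max) and his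
Conjecture 1.3 (the sum): Büyükboduk 2009 §4.2 Question 1 at the additive prime `3`, plus the Manin₃ shadow. J⁗ is implied by
J′ (drop the binder) AND by J‴ (a depth beyond every carrier is a multi-carrier frame), so nothing is lost and the research
statement only shrinks; after the Manin scaling of p583762/p600275 the flat form J⁗♭ (`3 ∤ c`) is what remains.

WHAT IS PROVED (pure logic over landed kernels; no definition, no named fact, no `sorry`; every statement CONDITIONAL on its
displayed hypotheses, nothing asserted about any curve):
* §1 `sigmaTowerFree_of_beyondMax_of_jetchevMax : hJmax → J⁗ → J′` (J′ BY NAME; case split on «some single carrier reaches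
  the depth»), the converses `beyondMax_of_sigmaTowerFree : J′ → J⁗` and `beyondMax_of_sigmaMultiCarrier : J‴ → J⁗` (J‴ = the
  hypothesis `hJm` of p598295 §2 = act G's `WildSigmaDivisibilityAtThreeMultiCarrier` text), and
  `wildKolyvaginUpperAtThreeTowerFree_of_beyondMax_of_jetchevMax_of_threePrimitives` — **Ko′ BY NAME ⟸ {CT, 3.7 (2), E0} +
  hJmax + J⁗** (∘ p594241 `koTowerFree_of_sigmaTowerFree_of_threePrimitives`).
* §2 `beyondMax_of_flatBeyondMax_of_maninScaling_of_jetchevMax : hJmax → J⁗♭ → ManinScaling₃ → J⁗` by datum scaling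
  (`c = k·c′`, `P(n) = k·P′(n)`; at depth `s′ − v₃ k` on the companion datum either a single carrier reaches — `hJmax` — or
  J⁗♭), and `wildKolyvaginUpperAtThreeTowerFree_of_flatBeyondMax_of_maninScaling_of_jetchevMax_of_threePrimitives` —
  **Ko′ BY NAME ⟸ {CT, 3.7 (2), E0} + hJmax + J⁗♭ + ManinScaling₃**.
So, in the kernel: the research input of the SOED Ko′ column is EXACTLY «`3^{s′} ∣ P(n)` in `E(K[n])` for
`max_q ord₃ c_q < s′ ≤ Σ_q ord₃ c_q` on data with `3 ∤ c`, at square-free Kolyvagin `n` with all indices `≥ s′`» (J⁗♭)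
⊕ ManinScaling₃ ⊕ the print {CT, 3.7 (2), E0, and (PT) behind `hJmax`}. `hJmax` is copied VERBATIM from p598295 §2 so that
its discharge (`jetchevMaxModThree_of_literature`, w2 g5) plugs in unchanged.

HONEST FRAMING. J⁗ / J⁗♭ are OPEN research (no Σ-sharp Kolyvagin-system divisibility beyond the max is in print at any prime;
at the additive prime `3` no Λ-adic control of the carriers exists; barrier `Literature/Barriers/BirchSwinnertonDyer/
StringentKolyvaginCapsAtMax`); ManinScaling₃ is the `3`-part of Manin's conjecture at `27 ∣ N` (off print); the primitives are
Literature named facts taken as hypotheses. Ko′, J′, Manin's conjecture and BSD stay open. BSD is not proved by this file.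

References: [Jetchev2008] Thm. 1.4, Cor. 1.5, Conj. 1.3 (p. 812; arXiv:math/0703431 p. 3); [Buyukboduk2009TamagawaDefect]
§4.2 Question 1; [McCallumLMS1991] §3, §5 Cor. 5.6 (p. 310); [Cha2005] Thm. 3, Thm. 7; [GrossLMS1991] Prop. 3.7 (2), §6;
[Darmon2004] Thm. 3.6; [CesnaviciusNeururerSaha2023] Thm. 1.2.
-/

set_option autoImplicit false
set_option linter.dupNamespace false -- `Summit.BirchSwinnertonDyer.BirchSwinnertonDyer.…` is the tree's layout (D-0017)

noncomputable section

open scoped Classical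

namespace Summit.BirchSwinnertonDyer.BirchSwinnertonDyer.Theorems.WildKolyvaginUpperAtThreeTowerFreeBeyondMax

open WeierstrassCurve NumberField Literature.NumberTheory.EllipticCurves
  Literature.NumberTheory.EllipticCurves.ModularForms
  Summit.BirchSwinnertonDyer.Rank1Residual
  Summit.BirchSwinnertonDyer.Rank1Residual.Additive
  Summit.BirchSwinnertonDyer.Rank1Residual.X11b.Three
  Summit.BirchSwinnertonDyer.BirchSwinnertonDyer.Theses.SemiOrdinaryEisensteinDescent
  Summit.BirchSwinnertonDyer.BirchSwinnertonDyer.Theorems.WildSigmaDivisibilityAtThreeOfFlatOfManinScaling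
open Literature.NumberTheory.EllipticCurves.GrossLMS1991 (prop37_2_frobeniusCongruence)

/-! ## §1 J′ = (Jetchev's max-form) ⊕ J⁗ (the depths beyond every single carrier) -/

/-- **J′ `WildSigmaDivisibilityAtThreeTowerFree` (stmt-24702) BY NAME ⟸ Jetchev's max-form at `3 ∣ N` under `ρ̄₃` onto
(`hJmax`, displayed VERBATIM as in p598295 §2) + J⁗ (`hJb`: J′'s text with ONE extra binder «`∀ q` prime, `q ∣ N →
ord₃ c_q(E/ℚ_q) < s′`» on the depth).** Proof: at a depth `s′ ≤ t` either some prime `q₀ ∣ N` has `s′ ≤ ord₃ c_{q₀}` — then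
`hJmax` at `q₀` — or every single carrier lies strictly below `s′` — then `hJb`. CONDITIONAL on both hypotheses (`hJmax` is
print modulo the `bsd-jet` binder weakening, Jetchev 2008 Thm. 1.4 / Cor. 1.5; `hJb` is open research, the gap between
Jetchev's theorem and his Conj. 1.3); nothing about any curve is asserted.
[cite: Jetchev2008, Thm. 1.4, Cor. 1.5 and Conj. 1.3 (p. 812)] [cite: Buyukboduk2009TamagawaDefect, §4.2 Question 1] -/
theorem sigmaTowerFree_of_beyondMax_of_jetchevMax
    (hJmax : ∀ (W : WeierstrassCurve ℚ) [W.IsElliptic] [W.IsGloballyMinimal] (N : ℕ) [NeZero N] (K : Type)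
      [Field K] [NumberField K] (Dt : ModularParametrizationData W N)
      (H : HeegnerDatum N (NumberField.discr K)) (ι : K →+* ℂ) (P : (W.baseChange K).toAffine.Point),
      ClassO6 W 3 → W.HasSurjectiveModNGaloisRep 3 → W.analyticRank = 1 → W.conductorNorm ℤ = N →
      IsImaginaryQuadratic K → SatisfiesHeegnerHypothesis N K →
      (W.quadraticTwist (NumberField.discr K : ℚ)).entireLFunction 1 ≠ 0 →
      WeierstrassCurve.Affine.Point.map ι.toRatAlgHom P = heegnerPointComplex Dt H →
      ¬ IsOfFinAddOrder P → Odd (NumberField.discr K) → NumberField.discr K ≠ -3 →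
      ∀ (q : ℕ) [Fact q.Prime], q ∣ N →
      ∀ (s' : ℕ), s' ≤ padicValNat 3 ((W.baseChange ℚ_[q]).localTamagawaNumber ℤ_[q]) →
        ∀ (n : ℕ) (d : KolyvaginHeegnerData Dt H.β ι n), Squarefree n →
          (∀ ℓ ∈ n.primeFactors, Zhang2014.IsKolyvaginPrime N W K 3 ℓ ∧
            s' ≤ Zhang2014.kolyvaginIndex W 3 ℓ) → Koly.PDiv d 3 s')
    (hJb : ∀ (W : WeierstrassCurve ℚ) [W.IsElliptic] [W.IsGloballyMinimal] (N : ℕ) [NeZero N] (K : Type)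
      [Field K] [NumberField K] (Dt : ModularParametrizationData W N)
      (H : HeegnerDatum N (NumberField.discr K)) (ι : K →+* ℂ) (P : (W.baseChange K).toAffine.Point),
      ClassO6 W 3 → W.HasSurjectiveModNGaloisRep 3 → W.analyticRank = 1 → W.conductorNorm ℤ = N →
      IsImaginaryQuadratic K → SatisfiesHeegnerHypothesis N K →
      (W.quadraticTwist (NumberField.discr K : ℚ)).entireLFunction 1 ≠ 0 →
      WeierstrassCurve.Affine.Point.map ι.toRatAlgHom P = heegnerPointComplex Dt H →
      ¬ IsOfFinAddOrder P → Odd (NumberField.discr K) → NumberField.discr K ≠ -3 →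
      ∀ (s' : ℕ), (∀ (q : ℕ) [Fact q.Prime], q ∣ N →
        padicValNat 3 ((W.baseChange ℚ_[q]).localTamagawaNumber ℤ_[q]) < s') →
      s' ≤ padicValNat 3 W.tamagawaProduct + padicValNat 3 Dt.c.natAbs →
        ∀ (n : ℕ) (d : KolyvaginHeegnerData Dt H.β ι n), Squarefree n →
          (∀ ℓ ∈ n.primeFactors, Zhang2014.IsKolyvaginPrime N W K 3 ℓ ∧
            s' ≤ Zhang2014.kolyvaginIndex W 3 ℓ) → Koly.PDiv d 3 s') :
    WildSigmaDivisibilityAtThreeTowerFree := by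
  intro W _ _ N _ K _ _ Dt H ι P hO6 hsurj hr hN hK hHH hL hP hnt hodd h3 s' hs' n d hn hℓ
  by_cases hm : ∀ (q : ℕ) [Fact q.Prime], q ∣ N →
      padicValNat 3 ((W.baseChange ℚ_[q]).localTamagawaNumber ℤ_[q]) < s'
  · exact hJb W N K Dt H ι P hO6 hsurj hr hN hK hHH hL hP hnt hodd h3 s' hm hs' n d hn hℓ
  · push Not at hm
    obtain ⟨q₀, hq₀, hq₀N, hcar⟩ := hm
    exact hJmax W N K Dt H ι P hO6 hsurj hr hN hK hHH hL hP hnt hodd h3 q₀ hq₀N s' hcar n d hn hℓ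

/-- **Nothing is lost: J′ ⟹ J⁗** (discard the depth binder). Bookkeeping; CONDITIONAL on J′; nothing asserted.
[cite: Jetchev2008, Conj. 1.3 (p. 812)] -/
theorem beyondMax_of_sigmaTowerFree (hJ' : WildSigmaDivisibilityAtThreeTowerFree) :
    ∀ (W : WeierstrassCurve ℚ) [W.IsElliptic] [W.IsGloballyMinimal] (N : ℕ) [NeZero N] (K : Type)
      [Field K] [NumberField K] (Dt : ModularParametrizationData W N)
      (H : HeegnerDatum N (NumberField.discr K)) (ι : K →+* ℂ) (P : (W.baseChange K).toAffine.Point),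
      ClassO6 W 3 → W.HasSurjectiveModNGaloisRep 3 → W.analyticRank = 1 → W.conductorNorm ℤ = N →
      IsImaginaryQuadratic K → SatisfiesHeegnerHypothesis N K →
      (W.quadraticTwist (NumberField.discr K : ℚ)).entireLFunction 1 ≠ 0 →
      WeierstrassCurve.Affine.Point.map ι.toRatAlgHom P = heegnerPointComplex Dt H →
      ¬ IsOfFinAddOrder P → Odd (NumberField.discr K) → NumberField.discr K ≠ -3 →
      ∀ (s' : ℕ), (∀ (q : ℕ) [Fact q.Prime], q ∣ N →
        padicValNat 3 ((W.baseChange ℚ_[q]).localTamagawaNumber ℤ_[q]) < s') →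
      s' ≤ padicValNat 3 W.tamagawaProduct + padicValNat 3 Dt.c.natAbs →
        ∀ (n : ℕ) (d : KolyvaginHeegnerData Dt H.β ι n), Squarefree n →
          (∀ ℓ ∈ n.primeFactors, Zhang2014.IsKolyvaginPrime N W K 3 ℓ ∧
            s' ≤ Zhang2014.kolyvaginIndex W 3 ℓ) → Koly.PDiv d 3 s' := by
  intro W _ _ N _ K _ _ Dt H ι P hO6 hsurj hr hN hK hHH hL hP hnt hodd h3 s' _ hs' n d hn hℓ
  exact hJ' W N K Dt H ι P hO6 hsurj hr hN hK hHH hL hP hnt hodd h3 s' hs' n d hn hℓ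

/-- **J⁗ is implied by the multi-carrier form J‴** (`hJm` = the hypothesis `hJm` of p598295 §2 VERBATIM = the text of the
pen's act-G item `WildSigmaDivisibilityAtThreeMultiCarrier`): a depth beyond every single carrier is `≤ t`, so every carrier is
`< t` and the frame is multi-carrier. Hence J′ ⟹ J‴ ⟹ J⁗, and Ko′ needs only J⁗ (below): the research statement shrinks from
FRAMES to DEPTHS. Bookkeeping; CONDITIONAL on J‴; nothing asserted. [cite: Buyukboduk2009TamagawaDefect, §4.2 Question 1] -/
theorem beyondMax_of_sigmaMultiCarrier
    (hJm : ∀ (W : WeierstrassCurve ℚ) [W.IsElliptic] [W.IsGloballyMinimal] (N : ℕ) [NeZero N] (K : Type)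
      [Field K] [NumberField K] (Dt : ModularParametrizationData W N)
      (H : HeegnerDatum N (NumberField.discr K)) (ι : K →+* ℂ) (P : (W.baseChange K).toAffine.Point),
      ClassO6 W 3 → W.HasSurjectiveModNGaloisRep 3 → W.analyticRank = 1 → W.conductorNorm ℤ = N →
      IsImaginaryQuadratic K → SatisfiesHeegnerHypothesis N K →
      (W.quadraticTwist (NumberField.discr K : ℚ)).entireLFunction 1 ≠ 0 →
      WeierstrassCurve.Affine.Point.map ι.toRatAlgHom P = heegnerPointComplex Dt H →
      ¬ IsOfFinAddOrder P → Odd (NumberField.discr K) → NumberField.discr K ≠ -3 →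
      (∀ (q : ℕ) [Fact q.Prime], q ∣ N →
        padicValNat 3 ((W.baseChange ℚ_[q]).localTamagawaNumber ℤ_[q]) <
          padicValNat 3 W.tamagawaProduct + padicValNat 3 Dt.c.natAbs) →
      ∀ (s' : ℕ), s' ≤ padicValNat 3 W.tamagawaProduct + padicValNat 3 Dt.c.natAbs →
        ∀ (n : ℕ) (d : KolyvaginHeegnerData Dt H.β ι n), Squarefree n →
          (∀ ℓ ∈ n.primeFactors, Zhang2014.IsKolyvaginPrime N W K 3 ℓ ∧
            s' ≤ Zhang2014.kolyvaginIndex W 3 ℓ) → Koly.PDiv d 3 s') :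
    ∀ (W : WeierstrassCurve ℚ) [W.IsElliptic] [W.IsGloballyMinimal] (N : ℕ) [NeZero N] (K : Type)
      [Field K] [NumberField K] (Dt : ModularParametrizationData W N)
      (H : HeegnerDatum N (NumberField.discr K)) (ι : K →+* ℂ) (P : (W.baseChange K).toAffine.Point),
      ClassO6 W 3 → W.HasSurjectiveModNGaloisRep 3 → W.analyticRank = 1 → W.conductorNorm ℤ = N →
      IsImaginaryQuadratic K → SatisfiesHeegnerHypothesis N K →
      (W.quadraticTwist (NumberField.discr K : ℚ)).entireLFunction 1 ≠ 0 →
      WeierstrassCurve.Affine.Point.map ι.toRatAlgHom P = heegnerPointComplex Dt H →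
      ¬ IsOfFinAddOrder P → Odd (NumberField.discr K) → NumberField.discr K ≠ -3 →
      ∀ (s' : ℕ), (∀ (q : ℕ) [Fact q.Prime], q ∣ N →
        padicValNat 3 ((W.baseChange ℚ_[q]).localTamagawaNumber ℤ_[q]) < s') →
      s' ≤ padicValNat 3 W.tamagawaProduct + padicValNat 3 Dt.c.natAbs →
        ∀ (n : ℕ) (d : KolyvaginHeegnerData Dt H.β ι n), Squarefree n →
          (∀ ℓ ∈ n.primeFactors, Zhang2014.IsKolyvaginPrime N W K 3 ℓ ∧
            s' ≤ Zhang2014.kolyvaginIndex W 3 ℓ) → Koly.PDiv d 3 s' := by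
  intro W _ _ N _ K _ _ Dt H ι P hO6 hsurj hr hN hK hHH hL hP hnt hodd h3 s' hbey hs' n d hn hℓ
  have hmulti : ∀ (q : ℕ) [Fact q.Prime], q ∣ N →
      padicValNat 3 ((W.baseChange ℚ_[q]).localTamagawaNumber ℤ_[q]) <
        padicValNat 3 W.tamagawaProduct + padicValNat 3 Dt.c.natAbs :=
    fun q _ hqN ↦ lt_of_lt_of_le (hbey q hqN) hs'
  exact hJm W N K Dt H ι P hO6 hsurj hr hN hK hHH hL hP hnt hodd h3 hmulti s' hs' n d hn hℓ

/-- **Crux of record Ko′ `WildKolyvaginUpperAtThreeTowerFree` (stmt-24696) BY NAME ⟸ {`∀ K, casselsTate_levelInputs K`,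
Gross 1991 Prop. 3.7 (2), GZ86 III (3.1)} + Jetchev's max-form mod `3` (`hJmax`, displayed) + J⁗ (`hJb`, the depths beyond
every single carrier).** = §1 `sigmaTowerFree_of_beyondMax_of_jetchevMax` composed with the tower-free McCallum-road
receptacle `WildKolyvaginUpperAtThreeTowerFree.koTowerFree_of_sigmaTowerFree_of_threePrimitives` (p594241). Compared with
p598295 §2 (same `hJmax`, research hypothesis on multi-carrier FRAMES) the research hypothesis here is on DEPTHS and is implied
by it (`beyondMax_of_sigmaMultiCarrier`). CONDITIONAL on the five displayed hypotheses; Ko′, J′ and BSD stay open.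
[cite: McCallumLMS1991, §5 Cor. 5.6 (p. 310)] [cite: Jetchev2008, Thm. 1.4 and Conj. 1.3 (p. 812)]
[cite: GrossLMS1991, Prop. 3.7 (2)] -/
theorem wildKolyvaginUpperAtThreeTowerFree_of_beyondMax_of_jetchevMax_of_threePrimitives
    (hCT : ∀ (K : Type) [Field K] [NumberField K], casselsTate_levelInputs K)
    (h372 : prop37_2_frobeniusCongruence) (hE0 : Gross1991_heegnerPoint_sub_ratTorsion_mem_E0)
    (hJmax : ∀ (W : WeierstrassCurve ℚ) [W.IsElliptic] [W.IsGloballyMinimal] (N : ℕ) [NeZero N] (K : Type)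
      [Field K] [NumberField K] (Dt : ModularParametrizationData W N)
      (H : HeegnerDatum N (NumberField.discr K)) (ι : K →+* ℂ) (P : (W.baseChange K).toAffine.Point),
      ClassO6 W 3 → W.HasSurjectiveModNGaloisRep 3 → W.analyticRank = 1 → W.conductorNorm ℤ = N →
      IsImaginaryQuadratic K → SatisfiesHeegnerHypothesis N K →
      (W.quadraticTwist (NumberField.discr K : ℚ)).entireLFunction 1 ≠ 0 →
      WeierstrassCurve.Affine.Point.map ι.toRatAlgHom P = heegnerPointComplex Dt H →
      ¬ IsOfFinAddOrder P → Odd (NumberField.discr K) → NumberField.discr K ≠ -3 →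
      ∀ (q : ℕ) [Fact q.Prime], q ∣ N →
      ∀ (s' : ℕ), s' ≤ padicValNat 3 ((W.baseChange ℚ_[q]).localTamagawaNumber ℤ_[q]) →
        ∀ (n : ℕ) (d : KolyvaginHeegnerData Dt H.β ι n), Squarefree n →
          (∀ ℓ ∈ n.primeFactors, Zhang2014.IsKolyvaginPrime N W K 3 ℓ ∧
            s' ≤ Zhang2014.kolyvaginIndex W 3 ℓ) → Koly.PDiv d 3 s')
    (hJb : ∀ (W : WeierstrassCurve ℚ) [W.IsElliptic] [W.IsGloballyMinimal] (N : ℕ) [NeZero N] (K : Type)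
      [Field K] [NumberField K] (Dt : ModularParametrizationData W N)
      (H : HeegnerDatum N (NumberField.discr K)) (ι : K →+* ℂ) (P : (W.baseChange K).toAffine.Point),
      ClassO6 W 3 → W.HasSurjectiveModNGaloisRep 3 → W.analyticRank = 1 → W.conductorNorm ℤ = N →
      IsImaginaryQuadratic K → SatisfiesHeegnerHypothesis N K →
      (W.quadraticTwist (NumberField.discr K : ℚ)).entireLFunction 1 ≠ 0 →
      WeierstrassCurve.Affine.Point.map ι.toRatAlgHom P = heegnerPointComplex Dt H →
      ¬ IsOfFinAddOrder P → Odd (NumberField.discr K) → NumberField.discr K ≠ -3 →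
      ∀ (s' : ℕ), (∀ (q : ℕ) [Fact q.Prime], q ∣ N →
        padicValNat 3 ((W.baseChange ℚ_[q]).localTamagawaNumber ℤ_[q]) < s') →
      s' ≤ padicValNat 3 W.tamagawaProduct + padicValNat 3 Dt.c.natAbs →
        ∀ (n : ℕ) (d : KolyvaginHeegnerData Dt H.β ι n), Squarefree n →
          (∀ ℓ ∈ n.primeFactors, Zhang2014.IsKolyvaginPrime N W K 3 ℓ ∧
            s' ≤ Zhang2014.kolyvaginIndex W 3 ℓ) → Koly.PDiv d 3 s') :
    WildKolyvaginUpperAtThreeTowerFree :=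
  WildKolyvaginUpperAtThreeTowerFree.koTowerFree_of_sigmaTowerFree_of_threePrimitives hCT h372 hE0
    (sigmaTowerFree_of_beyondMax_of_jetchevMax hJmax hJb)

/-! ## §2 The Manin slack removed from J⁗: J⁗ ⟸ Jetchev's max-form + J⁗♭ (`3 ∤ c`) + ManinScaling₃ -/

/-- **J⁗ ⟸ Jetchev's max-form mod `3` (`hJmax`) + J⁗♭ (`hFlatB`: J⁗ on data with `3 ∤ c(Dt)`, i.e. J′'s text with the two
extra binders `¬ (3 : ℤ) ∣ Dt.c` and «`∀ q` prime `∣ N, ord₃ c_q < s′`») + ManinScaling₃ (`hScal`, exactly as in p583762 /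
p600275).** Proof = the datum scaling of p600275 §1 with one more case: `c = k·c′` with `3 ∤ c′`, `P = k·P′`, `P(n) = k·P′(n)`
(`exists_scaled_kolyvaginHeegnerData`; the `K`-rationality of `y_K(Dt′)` is Darmon Thm. 3.6 PROVED,
`heegnerPointComplex_mem_range_map_holds`); at a depth `s′` beyond every carrier with `s′ ≤ ord₃ ∏ c_q + v₃ k`: if `s′ ≤ v₃ k`
the divisibility is free; otherwise `P′(n)` must be `3^{s′ − v₃ k}`-divisible, and either some single carrier reaches
`s′ − v₃ k` — `hJmax` on the companion datum — or none does — `hFlatB` on the companion datum (`3 ∤ c′`). CONDITIONAL on the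
three hypotheses (`hJmax` print modulo the `bsd-jet` binder weakening; `hFlatB` open research = Büyükboduk 2009 §4.2 Q1 at
the additive prime `3`; `hScal` = the `3`-part of Manin's conjecture at `27 ∣ N`, off print); nothing about any curve is asserted.
[cite: Jetchev2008, Rem. 1.2, Thm. 1.4 and Conj. 1.3 (p. 812)] [cite: Buyukboduk2009TamagawaDefect, §4.2 Question 1]
[cite: Darmon2004, Thm. 3.6] [cite: CesnaviciusNeururerSaha2023, Thm. 1.2] -/
theorem beyondMax_of_flatBeyondMax_of_maninScaling_of_jetchevMax
    (hJmax : ∀ (W : WeierstrassCurve ℚ) [W.IsElliptic] [W.IsGloballyMinimal] (N : ℕ) [NeZero N] (K : Type)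
      [Field K] [NumberField K] (Dt : ModularParametrizationData W N)
      (H : HeegnerDatum N (NumberField.discr K)) (ι : K →+* ℂ) (P : (W.baseChange K).toAffine.Point),
      ClassO6 W 3 → W.HasSurjectiveModNGaloisRep 3 → W.analyticRank = 1 → W.conductorNorm ℤ = N →
      IsImaginaryQuadratic K → SatisfiesHeegnerHypothesis N K →
      (W.quadraticTwist (NumberField.discr K : ℚ)).entireLFunction 1 ≠ 0 →
      WeierstrassCurve.Affine.Point.map ι.toRatAlgHom P = heegnerPointComplex Dt H →
      ¬ IsOfFinAddOrder P → Odd (NumberField.discr K) → NumberField.discr K ≠ -3 →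
      ∀ (q : ℕ) [Fact q.Prime], q ∣ N →
      ∀ (s' : ℕ), s' ≤ padicValNat 3 ((W.baseChange ℚ_[q]).localTamagawaNumber ℤ_[q]) →
        ∀ (n : ℕ) (d : KolyvaginHeegnerData Dt H.β ι n), Squarefree n →
          (∀ ℓ ∈ n.primeFactors, Zhang2014.IsKolyvaginPrime N W K 3 ℓ ∧
            s' ≤ Zhang2014.kolyvaginIndex W 3 ℓ) → Koly.PDiv d 3 s')
    (hFlatB : ∀ (W : WeierstrassCurve ℚ) [W.IsElliptic] [W.IsGloballyMinimal] (N : ℕ) [NeZero N] (K : Type)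
      [Field K] [NumberField K] (Dt : ModularParametrizationData W N)
      (H : HeegnerDatum N (NumberField.discr K)) (ι : K →+* ℂ) (P : (W.baseChange K).toAffine.Point),
      ClassO6 W 3 → W.HasSurjectiveModNGaloisRep 3 → W.analyticRank = 1 → W.conductorNorm ℤ = N →
      IsImaginaryQuadratic K → SatisfiesHeegnerHypothesis N K →
      (W.quadraticTwist (NumberField.discr K : ℚ)).entireLFunction 1 ≠ 0 →
      WeierstrassCurve.Affine.Point.map ι.toRatAlgHom P = heegnerPointComplex Dt H →
      ¬ IsOfFinAddOrder P → Odd (NumberField.discr K) → NumberField.discr K ≠ -3 →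
      ¬ (3 : ℤ) ∣ Dt.c →
      ∀ (s' : ℕ), (∀ (q : ℕ) [Fact q.Prime], q ∣ N →
        padicValNat 3 ((W.baseChange ℚ_[q]).localTamagawaNumber ℤ_[q]) < s') →
      s' ≤ padicValNat 3 W.tamagawaProduct + padicValNat 3 Dt.c.natAbs →
        ∀ (n : ℕ) (d : KolyvaginHeegnerData Dt H.β ι n), Squarefree n →
          (∀ ℓ ∈ n.primeFactors, Zhang2014.IsKolyvaginPrime N W K 3 ℓ ∧
            s' ≤ Zhang2014.kolyvaginIndex W 3 ℓ) → Koly.PDiv d 3 s')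
    (hScal : ∀ (W : WeierstrassCurve ℚ) [W.IsElliptic] [W.IsGloballyMinimal] (N : ℕ) [NeZero N],
      ClassO6 W 3 → W.HasSurjectiveModNGaloisRep 3 → W.analyticRank = 1 → W.conductorNorm ℤ = N →
      ∀ (Dt : ModularParametrizationData W N), ∃ (Dt' : ModularParametrizationData W N) (k : ℤ),
        Dt'.f = Dt.f ∧ Dt'.uniformize = Dt.uniformize ∧ Dt.c = k * Dt'.c ∧ ¬ (3 : ℤ) ∣ Dt'.c) :
    ∀ (W : WeierstrassCurve ℚ) [W.IsElliptic] [W.IsGloballyMinimal] (N : ℕ) [NeZero N] (K : Type)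
      [Field K] [NumberField K] (Dt : ModularParametrizationData W N)
      (H : HeegnerDatum N (NumberField.discr K)) (ι : K →+* ℂ) (P : (W.baseChange K).toAffine.Point),
      ClassO6 W 3 → W.HasSurjectiveModNGaloisRep 3 → W.analyticRank = 1 → W.conductorNorm ℤ = N →
      IsImaginaryQuadratic K → SatisfiesHeegnerHypothesis N K →
      (W.quadraticTwist (NumberField.discr K : ℚ)).entireLFunction 1 ≠ 0 →
      WeierstrassCurve.Affine.Point.map ι.toRatAlgHom P = heegnerPointComplex Dt H →
      ¬ IsOfFinAddOrder P → Odd (NumberField.discr K) → NumberField.discr K ≠ -3 →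
      ∀ (s' : ℕ), (∀ (q : ℕ) [Fact q.Prime], q ∣ N →
        padicValNat 3 ((W.baseChange ℚ_[q]).localTamagawaNumber ℤ_[q]) < s') →
      s' ≤ padicValNat 3 W.tamagawaProduct + padicValNat 3 Dt.c.natAbs →
        ∀ (n : ℕ) (d : KolyvaginHeegnerData Dt H.β ι n), Squarefree n →
          (∀ ℓ ∈ n.primeFactors, Zhang2014.IsKolyvaginPrime N W K 3 ℓ ∧
            s' ≤ Zhang2014.kolyvaginIndex W 3 ℓ) → Koly.PDiv d 3 s' := by
  intro W _ _ N _ K _ _ Dt H ι P hO6 hsurj hr hN hK hHH hL hP hnt hodd h3 s' hbey hs' n d hn hℓ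
  haveI : Fact (Nat.Prime 3) := ⟨Nat.prime_three⟩
  obtain ⟨Dt', k, hf, hu, hc, hc'⟩ := hScal W N hO6 hsurj hr hN Dt
  -- the `K`-rational Heegner point of `Dt′` (Darmon Thm. 3.6, PROVED) and `P = k·P′`
  obtain ⟨P', hP'⟩ := heegnerPointComplex_mem_range_map_holds N W K hK hHH Dt' H ι
  have hPk : P = k • P' := by
    apply WeierstrassCurve.Affine.Point.map_injective (W' := W) ι.toRatAlgHom
    rw [map_zsmul, hP, hP', heegnerPointComplex_eq_zsmul_of_scaling hf hu hc]
  have hnt' : ¬ IsOfFinAddOrder P' := fun h ↦ hnt (hPk ▸ h.zsmul)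
  have hk0 : k ≠ 0 := by
    rintro rfl
    exact hnt (by rw [hPk, zero_smul]; exact IsOfFinAddOrder.zero)
  -- `v₃(c(Dt)) = v₃(k)`
  set v := padicValNat 3 k.natAbs with hv
  have hc'0 : Dt'.c ≠ 0 := by rintro h; exact hc' (h ▸ dvd_zero 3)
  have hvc : padicValNat 3 Dt.c.natAbs = v := by
    rw [hc, Int.natAbs_mul, padicValNat.mul (Int.natAbs_ne_zero.mpr hk0) (Int.natAbs_ne_zero.mpr hc'0),
      padicValNat.eq_zero_of_not_dvd (fun h ↦ hc' (Int.natCast_dvd.mpr h)), add_zero]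
  -- `3^v ∣ k`
  obtain ⟨m, hm⟩ : ((3 ^ v : ℕ) : ℤ) ∣ k := Int.natCast_dvd.mpr pow_padicValNat_dvd
  -- the companion datum `d′` with `P(n) = k·P′(n)`
  have hn0 : n ≠ 0 := hn.ne_zero
  have hcop : Nat.Coprime n N := Nat.coprime_of_dvd fun q hq hqn hqN ↦
    (hℓ q (Nat.mem_primeFactors.mpr ⟨hq, hqn, hn0⟩)).1.2.1 hqN
  obtain ⟨d', hd'⟩ := exists_scaled_kolyvaginHeegnerData hK hHH hf hu hc hn0 hcop d
  by_cases hsv : s' ≤ v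
  · -- free: `3^{s′} ∣ k`
    obtain ⟨m', hm'⟩ : ((3 ^ s' : ℕ) : ℤ) ∣ k :=
      (Int.natCast_dvd_natCast.mpr (pow_dvd_pow 3 hsv)).trans ⟨m, hm⟩
    exact ⟨m' • d'.derivedPoint, by rw [← mul_smul, ← hm', hd']⟩
  · -- depth `s′ − v` on `d′`: a single carrier reaches it (Jetchev's max) or none does (J⁗♭, `3 ∤ c′`)
    push Not at hsv
    have hb : s' - v ≤ padicValNat 3 W.tamagawaProduct + padicValNat 3 Dt'.c.natAbs := by omega
    have hℓ' : ∀ ℓ ∈ n.primeFactors, Zhang2014.IsKolyvaginPrime N W K 3 ℓ ∧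
        s' - v ≤ Zhang2014.kolyvaginIndex W 3 ℓ := fun ℓ hℓn ↦
      ⟨(hℓ ℓ hℓn).1, le_trans (Nat.sub_le _ _) (hℓ ℓ hℓn).2⟩
    have hdiv : Koly.PDiv d' 3 (s' - v) := by
      by_cases hmx : ∀ (q : ℕ) [Fact q.Prime], q ∣ N →
          padicValNat 3 ((W.baseChange ℚ_[q]).localTamagawaNumber ℤ_[q]) < s' - v
      · exact hFlatB W N K Dt' H ι P' hO6 hsurj hr hN hK hHH hL hP' hnt' hodd h3 hc' (s' - v) hmx hb n d' hn hℓ'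
      · push Not at hmx
        obtain ⟨q₀, hq₀, hq₀N, hcar⟩ := hmx
        exact hJmax W N K Dt' H ι P' hO6 hsurj hr hN hK hHH hL hP' hnt' hodd h3 q₀ hq₀N (s' - v) hcar n d' hn hℓ'
    obtain ⟨Q', hQ'⟩ := hdiv
    refine ⟨m • Q', ?_⟩
    have hpow : ((3 ^ s' : ℕ) : ℤ) * m = k * ((3 ^ (s' - v) : ℕ) : ℤ) := by
      have h3 : (3 : ℤ) ^ s' = 3 ^ v * 3 ^ (s' - v) := by
        rw [← pow_add, Nat.add_sub_cancel' hsv.le]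
      rw [hm]; push_cast
      rw [h3]; ring
    rw [← mul_smul, hpow, mul_smul, hQ', hd']

/-- **Crux of record Ko′ `WildKolyvaginUpperAtThreeTowerFree` (stmt-24696) BY NAME ⟸ {`∀ K, casselsTate_levelInputs K`,
Gross 1991 Prop. 3.7 (2), GZ86 III (3.1)} + Jetchev's max-form mod `3` (`hJmax`) + J⁗♭ (`hFlatB`) + ManinScaling₃ (`hScal`).**
= §2 ∘ §1 ∘ p594241. In the kernel the research input of the SOED Ko′ column is therefore EXACTLY J⁗♭ — «`3^{s′} ∣ P(n)` for
`max_q ord₃ c_q < s′ ≤ Σ_q ord₃ c_q`, data with `3 ∤ c`» (Büyükboduk 2009 §4.2 Question 1 at the additive prime `3`) — plus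
ManinScaling₃, plus print. CONDITIONAL on all six displayed hypotheses; Ko′, J′, Manin's conjecture and BSD stay open.
[cite: McCallumLMS1991, §5 Cor. 5.6 (p. 310)] [cite: Jetchev2008, Thm. 1.4 and Conj. 1.3 (p. 812)]
[cite: Buyukboduk2009TamagawaDefect, §4.2 Question 1] [cite: CesnaviciusNeururerSaha2023, Thm. 1.2] -/
theorem wildKolyvaginUpperAtThreeTowerFree_of_flatBeyondMax_of_maninScaling_of_jetchevMax_of_threePrimitives
    (hCT : ∀ (K : Type) [Field K] [NumberField K], casselsTate_levelInputs K)
    (h372 : prop37_2_frobeniusCongruence) (hE0 : Gross1991_heegnerPoint_sub_ratTorsion_mem_E0)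
    (hJmax : ∀ (W : WeierstrassCurve ℚ) [W.IsElliptic] [W.IsGloballyMinimal] (N : ℕ) [NeZero N] (K : Type)
      [Field K] [NumberField K] (Dt : ModularParametrizationData W N)
      (H : HeegnerDatum N (NumberField.discr K)) (ι : K →+* ℂ) (P : (W.baseChange K).toAffine.Point),
      ClassO6 W 3 → W.HasSurjectiveModNGaloisRep 3 → W.analyticRank = 1 → W.conductorNorm ℤ = N →
      IsImaginaryQuadratic K → SatisfiesHeegnerHypothesis N K →
      (W.quadraticTwist (NumberField.discr K : ℚ)).entireLFunction 1 ≠ 0 →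
      WeierstrassCurve.Affine.Point.map ι.toRatAlgHom P = heegnerPointComplex Dt H →
      ¬ IsOfFinAddOrder P → Odd (NumberField.discr K) → NumberField.discr K ≠ -3 →
      ∀ (q : ℕ) [Fact q.Prime], q ∣ N →
      ∀ (s' : ℕ), s' ≤ padicValNat 3 ((W.baseChange ℚ_[q]).localTamagawaNumber ℤ_[q]) →
        ∀ (n : ℕ) (d : KolyvaginHeegnerData Dt H.β ι n), Squarefree n →
          (∀ ℓ ∈ n.primeFactors, Zhang2014.IsKolyvaginPrime N W K 3 ℓ ∧
            s' ≤ Zhang2014.kolyvaginIndex W 3 ℓ) → Koly.PDiv d 3 s')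
    (hFlatB : ∀ (W : WeierstrassCurve ℚ) [W.IsElliptic] [W.IsGloballyMinimal] (N : ℕ) [NeZero N] (K : Type)
      [Field K] [NumberField K] (Dt : ModularParametrizationData W N)
      (H : HeegnerDatum N (NumberField.discr K)) (ι : K →+* ℂ) (P : (W.baseChange K).toAffine.Point),
      ClassO6 W 3 → W.HasSurjectiveModNGaloisRep 3 → W.analyticRank = 1 → W.conductorNorm ℤ = N →
      IsImaginaryQuadratic K → SatisfiesHeegnerHypothesis N K →
      (W.quadraticTwist (NumberField.discr K : ℚ)).entireLFunction 1 ≠ 0 →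
      WeierstrassCurve.Affine.Point.map ι.toRatAlgHom P = heegnerPointComplex Dt H →
      ¬ IsOfFinAddOrder P → Odd (NumberField.discr K) → NumberField.discr K ≠ -3 →
      ¬ (3 : ℤ) ∣ Dt.c →
      ∀ (s' : ℕ), (∀ (q : ℕ) [Fact q.Prime], q ∣ N →
        padicValNat 3 ((W.baseChange ℚ_[q]).localTamagawaNumber ℤ_[q]) < s') →
      s' ≤ padicValNat 3 W.tamagawaProduct + padicValNat 3 Dt.c.natAbs →
        ∀ (n : ℕ) (d : KolyvaginHeegnerData Dt H.β ι n), Squarefree n →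
          (∀ ℓ ∈ n.primeFactors, Zhang2014.IsKolyvaginPrime N W K 3 ℓ ∧
            s' ≤ Zhang2014.kolyvaginIndex W 3 ℓ) → Koly.PDiv d 3 s')
    (hScal : ∀ (W : WeierstrassCurve ℚ) [W.IsElliptic] [W.IsGloballyMinimal] (N : ℕ) [NeZero N],
      ClassO6 W 3 → W.HasSurjectiveModNGaloisRep 3 → W.analyticRank = 1 → W.conductorNorm ℤ = N →
      ∀ (Dt : ModularParametrizationData W N), ∃ (Dt' : ModularParametrizationData W N) (k : ℤ),
        Dt'.f = Dt.f ∧ Dt'.uniformize = Dt.uniformize ∧ Dt.c = k * Dt'.c ∧ ¬ (3 : ℤ) ∣ Dt'.c) :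
    WildKolyvaginUpperAtThreeTowerFree :=
  wildKolyvaginUpperAtThreeTowerFree_of_beyondMax_of_jetchevMax_of_threePrimitives hCT h372 hE0 hJmax
    (beyondMax_of_flatBeyondMax_of_maninScaling_of_jetchevMax hJmax hFlatB hScal)

end Summit.BirchSwinnertonDyer.BirchSwinnertonDyer.Theorems.WildKolyvaginUpperAtThreeTowerFreeBeyondMax

end
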